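import Mathlib
import HarnessLib
import Summits.NavierStokesRegularity.NavierStokesRegularity.Theorems.UnthreadedRigidityDoorUnthreadedRigidityVirialHornBridgeWOfInjective
import Summits.NavierStokesRegularity.NavierStokesRegularity.Theorems.UnthreadedRigidityDoorUnthreadedRigidityCoZonalSilence

/-!
# W2 door `UnthreadedRigidity` — LINE g12-1 «CO-ZONAL»: O1-W by name and the window rung modulo the residual R

engine-1 g71 (KEY-NS #205 (e)).  O1-W `WindowOrderOneSilence` — at every time of an unthreaded window (hypotheses of 27585
verbatim, preconnectedness not needed) the formal first jet `fluxJetOne (u t) x₀` vanishes identically — is, hypothesis for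
hypothesis, ns-crc-p2 g8's `VirialHorn.fluxJetOne_eq_zero_of_unthreaded_window` (`…VirialHornBridgeWOfInjective`, classical
pressure on a strip + the open-window dictionary); here it is recorded BY NAME, and with `…CoZonalSilence` the WINDOW RUNG of the
line reduces to the residual R alone: `LinkedPairWindowRigidityAll → TwoShellWindowRigidityAll`.

LABEL: compositions of a MODEL line (W2 door, item 27585 OPEN); nothing here bears on NS regularity.  0 kit.
-/

-- the summit and its single sub-problem share the name (CONVENTIONS §1), as in every Theorems file
set_option linter.dupNamespace false

namespace Summit.NavierStokesRegularity.NavierStokesRegularity.Theorems.UnthreadedRigidity.CoZonal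

open Summit.NavierStokesRegularity.NavierStokesRegularity.Theorems.UnthreadedRigidity.VirialHorn

/-- ★ BRIDGE O1-W «WINDOW ORDER-ONE SILENCE» (`WindowOrderOneSilence`, LINE g12-1 CO-ZONAL, ns-idea-6 `CoZonal_sketch`
c7eabdeb25f1685c), by name: ns-crc-p2 g8's `fluxJetOne_eq_zero_of_unthreaded_window`. -/
theorem windowOrderOneSilence_holds : WindowOrderOneSilence := by
  intro S hS u x₀ hcont hdiv hmild hbdd hunth t ht x
  exact fluxJetOne_eq_zero_of_unthreaded_window hS hcont hdiv hmild hbdd hunth ht x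

/-- ★ THE WINDOW RUNG OF LINE g12-1 MODULO THE RESIDUAL R: `LinkedPairWindowRigidityAll → TwoShellWindowRigidityAll`
(O1-W, O1₂, CZ, Z⁺ all by name). -/
theorem twoShellWindowRigidityAll_of_linkedPair (hR : LinkedPairWindowRigidityAll) : TwoShellWindowRigidityAll :=
  twoShellWindowRigidityAll_of_residual windowOrderOneSilence_holds hR

/-- the same at one degree pair. -/
theorem twoShellWindowRigidity_of_linkedPair {l₁ l₂ : ℕ} (hl₁ : 1 ≤ l₁) (hl₂ : 1 ≤ l₂) (hne : l₁ ≠ l₂)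
    (hR : LinkedPairWindowRigidity l₁ l₂) : TwoShellWindowRigidity l₁ l₂ :=
  twoShellWindowRigidity_of_bridges l₁ l₂ hl₁ hl₂ hne windowOrderOneSilence_holds twoShellSliceOrderOneLaw_holds
    coZonalLemma_holds coZonalShellAxisym_holds hR

end Summit.NavierStokesRegularity.NavierStokesRegularity.Theorems.UnthreadedRigidity.CoZonal
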